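import Summits.AnomalousDissipation.AnomalousDissipation.Theses.MomentParity
import Summits.AnomalousDissipation.AnomalousDissipation.Theorems.QuarticGate.Negative.LevelCeiling
import Summits.AnomalousDissipation.AnomalousDissipation.Theorems.QuarticGate.Negative.EnergyRow
import Literature.Analysis.FluidPDE.GalerkinFlow
import Literature.Analysis.FluidPDE.EnergySpaceRellich
import Summits.AnomalousDissipation.AnomalousDissipation.Theorems.MomentParityGalerkinInvariantLoudStubEnergyFloor
import Summits.AnomalousDissipation.AnomalousDissipation.Theorems.MomentParityGalerkinInvariantLoudStubTaylorReduction
import Summits.AnomalousDissipation.AnomalousDissipation.Theorems.MomentParityGalerkinInvariantLoudStubKrylovBogoliubov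

/-!
# Line `taylor-cone-homogenisation` for crux `MomentParity.GalerkinInvariantLoud` (stmt-AnomalousDissipation-14283)

crux-plan (opening, round 1), planner-cruxplan-stmt-AnomalousDissipation-14283-taylor-cone-homogeni-0,
2026-08-16. Idea card `Cruxes/GalerkinInvariantLoud/Ideas/taylor-cone-homogenisation.md` (crux-ideate r1,
ideator 2), MERGED — as all three triagers asked (TRIAGE-r1-1/2/3: pass · pass · pass, "merge
taylor-cone-homogenisation ≈ rayleigh-floor-one-trajectory: ONE line 'Taylor-ratio'") — with the one-trajectory
form of `Ideas/rayleigh-floor-one-trajectory.md` (ideator 3). Line card: `Lines/taylor-cone-homogenisation.md`.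

## The line in one paragraph

The crux GIL asks, along `ν_j → 0`, for compactly supported level-`N` Galerkin-INVARIANT probability laws
(all-order polynomially stationary: `∀ d, IsPolyStationary ν f N d μ`, = cdisprove's `IsInvariant`) inside a two-sided WINDOW: mean energy `≤ E`, dissipation
`≥ ε`. Two EXACT rows that every such law satisfies — the ENERGY row `ν∫‖∇u‖²dμ = ∫(u,f)dμ ≤ ‖f‖₂√e`
(landed: `IsGILWitness.dissipation_eq`, `ensembleDissipation_le_of_polyStationary`) and the LINEAR row of
`(u, P_N f)` (mean momentum balance tested on the force: `‖P_N f‖² = −ν∫(u,ΔP_N f) − ∫(u⊗u):∇P_N f ≤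
ν‖Δf‖₂√e + G_f e`, an ENERGY FLOOR `e ≥ e₀(f) > 0` for `ν ≤ ν₀(f)`, `N ≥ N₀(f)`; cdisprove §5
`exists_energyFloor` is its band-limited case) — make both walls of the window COROLLARIES of ONE homogeneous
inequality, the TAYLOR CONE `κ∫|u|²dμ ≤ ν_j∫‖∇u‖²dμ` (mean Taylor microscale `≤ (ν_j/κ)^{1/2}`):
ceiling `e ≤ ‖f‖₂²/κ²` from the energy row, loudness `ε := κ e₀` from the floor. So
GIL ⟺ TSE := "for some `f ≠ 0`, `ν_j → 0`, `κ > 0`: per `j`, `N`-frequently, an invariant level-`N` law in the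
cone" (`stub_taylorReduction`; the converse `taylorConverse` is PROVED below, so the transfer is lossless), and,
by Krylov–Bogoliubov at level `N` (`stub_krylovBogoliubov`, the support coming for free in the absorbing ball
`‖u‖ ≤ ‖f‖₂/(4π²ν)`), TSE ⟸ OTT := "per `(j, N)` ONE Galerkin datum whose orbit has
`liminf_T ν_j∫₀ᵀ‖∇u‖² / ∫₀ᵀ|u|² ≥ κ`" (`stub_oneTrajectoryTaylor`, THE open stub: one datum, one number —
no energy control, no support radius, no pointwise floor, no running-average uniformity). The composition
`GalerkinInvariantLoud_of` is kernel-checked and concludes `MomentParity.GalerkinInvariantLoud` BY NAME.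

## Stubs (4) and composition — STATUS (lead prover-line-stmt-AnomalousDissipation-14283-0, wave 1, 2026-08-16):
## S1, S2, S3 LANDED (sorry-free, standard axioms, `--supports stmt-AnomalousDissipation-14283`); ONE sorry left = S4.

* `stub_energyFloor`        (S1) LANDED p91180 — `Theorems/MomentParityGalerkinInvariantLoudStubEnergyFloor.lean`
                             (`…Theorems.GalerkinInvariantLoud.EnergyFloor.stub_energyFloor`, 286 lines: row of
                             `(u, P_N f)`, `G = sup_N ‖∇P_N f‖_∞` via `partialDeriv_fourierTruncate`, `N₀` from
                             `∫‖P_N f‖² → ∫‖f‖²`; the level clause is unused).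
* `stub_taylorReduction`    (S2) LANDED p88725 — `Theorems/MomentParityGalerkinInvariantLoudStubTaylorReduction.lean`
                             (`…TaylorReduction.stub_taylorReduction`, 128 lines; helper `energy_le_of_cone`).
* `stub_krylovBogoliubov`   (S3) LANDED p90945 + helper A p88208 —
                             `Theorems/MomentParityGalerkinInvariantLoudStubKrylovBogoliubov{,A}.lean`
                             (`…KrylovBogoliubov.stub_krylovBogoliubov`; reusable: uniform orbit energy bound
                             `energy_le_of_isGalerkinODESolution`, lift lemmas, abstract K–B `exists_cesaro_limit`,
                             `integral_eq_zero_of_cesaro`, `mul_integral_le_integral_of_liminf`,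
                             `hasDerivAt_pairing_lift`, `hasDerivAt_eval_lift`).
* `stub_oneTrajectoryTaylor` (S4, THE LOAD-BEARING OPEN STUB; XL) one trajectory per `(j, N)` with Taylor
                             ratio `≥ κ`, `κ` uniform in `j`; `f ≠ 0` (triage r1-2 mandatory fix). OPEN — it is
                             the crux in ratio currency (GIL ⇒ S4 by ergodic decomposition + Birkhoff on a cone
                             law; S4 ⇒ GIL = this file). Numerics: cdisprove j012899 (Kolmogorov m=2,
                             ν ∈ [1e-3, 8e-3], N ≤ 16: κ_KB = 0.36–0.68) and the lead's j015659 (TG + Kolmogorov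
                             m=1, ν = 1e-2 … 6.25e-4 at N ≍ 1.3 k_η, resolution doubling).
* `GalerkinInvariantLoud_of : GalerkinInvariantLoud` — `S2 S1 (TSE)`, TSE from S4 and S3 by
  `Frequently.mono` with `R_j := ‖f‖₂/(4π²ν_j)`; no sorry of its own.
Proved in this file (not stubs): `taylorConverse` (GIL → TSE, `κ := ε/E`: the reparametrisation is an
EQUIVALENCE), `cone_level` (a cone witness with `e > 0` lives at `N ≥ (κ/ν)^{1/2}/2π`: Bernstein),
`certificate_excludes_cone` (the disprover-facing half: a one-multiplier polynomial certificate
`LV + δ ≤ κ|u|² − ν‖∇u‖²` on the level-`N` fields of a ball excludes every cone witness supported there),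
with the helpers `ensembleDissipation_eq_integral_of_isLevel`, `toReal_eGradNormSq_le_of_isLevel'`,
`integrable_norm_pow_of_ae_le'`.

Vocabulary (all LANDED, so every stub lands verbatim as a `Theorems/MomentParityGalerkinInvariantLoud…` file):
`IsLevel / IsBandTest / polyGrad / IsPolyStationary` (`Theorems/QuarticGate/Negative/LevelCeiling.lean`),
`IsQuarticWitness.eps_le`, `ensembleDissipation_le_of_polyStationary` (`…/EnergyRow.lean`), `Torus.galerkinFlow`,
`IsGalerkinMode` (`Literature/Analysis/FluidPDE/GalerkinFlow.lean`). All-order invariance is written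
`∀ d : ℕ, IsPolyStationary ν f N d μ` (= cdisprove's `IsInvariant ν f N μ` by `isInvariant_iff_forall`; the landed
`Theorems/GalerkinInvariantLoud/Negative/Clauses.lean`, p80511, is not yet built on the farm at planning time, so it
is READ, not imported). Inlined shapes:
* TSE (TaylorScaleEnsemble) := `∃ f` smooth div-free mean-zero, `f ≠ 0`, `∃ ν κ`, `ν_j > 0`, `ν_j → 0`, `0 < κ`,
  `∀ j ∃ R ∃ᶠ N ∃ μ`, probability ∧ a.e. `IsLevel N` ∧ a.e. `‖u‖ ≤ R` ∧ `∀ d, IsPolyStationary (ν j) f N d μ` ∧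
  `κ * ensembleEnergy μ ≤ ensembleDissipation (ν j) μ` (the crux's clause order, `R` before `N`);
* ratio(T) := `(ν (∫⁻ t in Ioo 0 T, eGradNormSq (galerkinFlow ν f N t a)).toReal) / (∫ t in 0..T, ∫ x, ‖galerkinFlow ν f N t a x‖²)`
  — cumulative dissipation over cumulative energy of ONE orbit; in `[0, 4π²N²ν]` by Bernstein, so `Filter.liminf`
  is the honest liminf (triage r1-2/r1-3 junk audit); `0/0 = 0`.

## Disproof.lean (cdisprove cycle 1 + rev 2, NO KILL) — read at start and before publishing; honoured:
§2 `dissipation_eq` / `eps_le_force` ARE the ceiling half of S2 (their certified form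
`ensembleDissipation_le_of_polyStationary` of `QuarticGate/Negative/EnergyRow.lean` is imported and used in
`taylorConverse`); `eps_le_level` ⇒ `cone_level` (the cone
needs `N ≥` Taylor wavenumber — the `∃ᶠ N` of S4, never a bounded level: `not_gilBoundedLevel` respected);
`not_gilEveryForce` / `isGILWitness_dirac_zero` ⇒ the clause `f ≠ 0` in TSE and S4 (with `f = 0` a decaying
shear eigenmode would inhabit S4: TRIAGE-r1-2 `TriageR1K2RatioFloorTrivial.lean`); `not_gilSubFloor` is the
window shadow of `e ≤ ‖f‖₂²/κ²`; `not_gilSmallRadius` / §3 `ae_norm_le_absorbing`: S3 delivers the absorbing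
radius `‖f‖₂/(4π²ν)` itself, so `R` carries no information (as §3 says); `gilWithoutEnergyCeiling_holds` /
`gilFixedViscosity_holds` (laminar Kolmogorov Diracs): in cone form the laminar state has ratio `νλ_f → 0` and
is excluded with no energy wall — `ν_j → 0` and the `j`-uniform `κ` are the load-bearing clauses of TSE/S4;
§4 `exists_efficient_steady_atom`: an efficient steady atom (`ε‖u‖² ≤ E·ν‖∇u‖²`) is exactly a CONSTANT-ORBIT
witness of S4 with `κ = ε/E` — the atomic corner of this line; §5 `exists_energyFloor` = S1 for band-limited
`f` with an existential constant (S1 adds the truncation bookkeeping and the threshold form). No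
`_false_without_` theorem and no `-- Targets` stub kills are posted (payload.targets = []); no stub is an
instance of a refuted strengthening (`GILBoundedLevel`, `GILEveryForce`, `GILSubFloor`, `GILSmallRadius`).
Negatives index (5 items: 0204, 13037, 2979, 2984, 2859): none in ratio/cone/one-trajectory form.
-/

namespace Summit.AnomalousDissipation.AnomalousDissipation.Cruxes.GalerkinInvariantLoud.TaylorConeHomogenisation

open MeasureTheory Filter Topology Set
open scoped ENNReal
open Literature.Analysis.FunctionSpaces Literature.Analysis.FluidPDE
open Summit.AnomalousDissipation.AnomalousDissipation.Theses.MomentParity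
open Summit.AnomalousDissipation.AnomalousDissipation.Theorems.QuarticGate.Negative

set_option linter.dupNamespace false

noncomputable section

/-! ## The stubs -/

/-- **S1 — ENERGY FLOOR from the linear row (threshold form; the lever's new half).**
For every smooth divergence-free mean-zero force `f ≠ 0` there are `e₀, ν₀ > 0` and a level `N₀` such that
at every viscosity `0 < ν ≤ ν₀` and every level `N ≥ N₀`, EVERY level-`N` probability law with finite mean
energy whose LINEAR rows vanish (`IsPolyStationary ν f N 2 μ`: observables of degree `≤ 1`; in particular
every all-order invariant law of the crux, every `QuarticGate`/`CubicParityLoud` witness) has mean energy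
`∫|u|²dμ ≥ e₀`. "Bounded" in the crux never means "small": the window is the band `e₀(f) ≤ e ≤ E`.
Why true (M, provable now): test the degree-1 observable `(u, P_N f)` (`m = 1`, `g₀ = fourierTruncate N f`,
`P = X 0`; `P_N f` is a band test: trigonometric polynomial, div-free, mean-zero, band-limited): the row reads
`‖P_N f‖₂² + ν∫(u, ΔP_N f)dμ + ∫ inertialPairing(u, P_N f) dμ = 0`; `|∫(u,ΔP_N f)| ≤ ‖Δf‖₂√e` (Cauchy–Schwarz,
Jensen), `|inertialPairing(u, P_N f)| ≤ G‖u‖²` with `G := sup_N ‖∇P_N f‖_∞ ≤ 2πΣ_k|k|‖f̂(k)‖ < ∞` (smooth `f`;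
TRIAGE-r1-3: NOT `‖∇f‖_∞`, truncation is no `L∞` contraction), `‖P_N f‖₂² ≥ ‖f‖₂²/2` for `N ≥ N₀`; put
`e₀ := ‖f‖₂²/(4(G+1))`, `ν₀ := ‖f‖₂²/(4(‖Δf‖₂√e₀ + 1))`: `e < e₀` would give `‖f‖²/2 < ‖f‖²/4 + ‖f‖²/4`.
Template: cdisprove `Disproof.lean` §5 `exists_energyFloor` (band-limited `f`, 80 lines:
`nsGeneratorPairing_polyGrad_X`, `Torus.exists_sum_norm_partialDeriv_le`,
`Torus.integrable_inner_fderiv_apply_coe`, `Torus.continuous_inertialPairing_coe`, `Torus.abs_pairing_coe_le`).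
Numbers (card kit j012263): `e₀ → ‖f‖²/Λ_∞(f)`: `1/(2π)` (unit Kolmogorov), `1/(8π)` (unit Taylor–Green);
K–B ensembles sit at `5–8 × e₀`. -/
theorem stub_energyFloor :
    ∀ f : UnitAddTorus (Fin 3) → EuclideanSpace ℝ (Fin 3),
      Torus.IsSmooth f → Torus.IsDivFree f → Torus.HasZeroMean f → f ≠ 0 →
      ∃ e₀ ν₀ : ℝ, 0 < e₀ ∧ 0 < ν₀ ∧ ∃ N₀ : ℕ, ∀ ν : ℝ, 0 < ν → ν ≤ ν₀ → ∀ N : ℕ, N₀ ≤ N →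
        ∀ μ : Measure (Torus.energySpace (Fin 3)), IsProbabilityMeasure μ →
          (∀ᵐ u ∂μ, IsLevel N u) →
          Integrable (fun u : Torus.energySpace (Fin 3) => ‖u‖ ^ 2) μ →
          IsPolyStationary ν f N 2 μ →
          e₀ ≤ Torus.ensembleEnergy μ :=
  -- LANDED (wave 1, p91180): Theorems/MomentParityGalerkinInvariantLoudStubEnergyFloor.lean
  Summit.AnomalousDissipation.AnomalousDissipation.Theorems.GalerkinInvariantLoud.EnergyFloor.stub_energyFloor

/-- **S2 — TAYLOR REDUCTION (the Transfer `C⁺ → crux`): a Taylor-scale ensemble IS loud and bounded.**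
Hypotheses: the energy floor S1 (verbatim) and TSE = "`∃ f` smooth div-free mean-zero, `f ≠ 0`, `ν_j → 0⁺`,
`κ > 0`, `∀ j ∃ R ∃ᶠ N ∃ μ` probability, level-`N` carried, supported in `‖u‖ ≤ R`, all-order invariant
(`∀ d, IsPolyStationary (ν j) f N d μ`), IN THE CONE `κ∫|u|²dμ ≤ ν_j∫‖∇u‖²dμ`". Conclusion: the crux
(unfolded clause for clause, definitionally `MomentParity.GalerkinInvariantLoud`; cf. cdisprove's
`galerkinInvariantLoud_iff := Iff.rfl`).
Why true (M, provable now; ~80 lines of real arithmetic): (floor) `e₀, ν₀, N₀` from S1 for this `f`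
(`hinv 2`; `Integrable ‖u‖²` from the support bound, `integrable_norm_pow_of_ae_le'`); (re-index) `ν_j → 0` gives `J` with
`ν_j ≤ ν₀` for `j ≥ J` — put `ν' j := ν (j + J)` (still positive, still `→ 0`: `tendsto_add_atTop_nat`);
(ceiling, LANDED `ensembleDissipation_le_of_polyStationary`, i.e. cdisprove `dissipation_eq` + Cauchy–Schwarz)
`κe ≤ D ≤ ‖f‖₂√e`, so `e ≤ E := ‖f‖₂²/κ²` (trivial if `e = 0`); (loud) inside `∃ᶠ N` intersect with
`eventually (N₀ ≤ N)` (`Frequently.and_eventually`) and get `D ≥ κe ≥ κe₀ =: ε > 0`; `R` is TSE's own.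
Then `⟨f, …, ν', E, ε, …⟩` (all-order rows from `hinv : ∀ d, IsPolyStationary …` by
`fun m g P hg => hinv (P.totalDegree + 1) m g P hg le_rfl`, cf. `isInvariant_iff_forall`). -/
theorem stub_taylorReduction :
    (∀ f : UnitAddTorus (Fin 3) → EuclideanSpace ℝ (Fin 3),
      Torus.IsSmooth f → Torus.IsDivFree f → Torus.HasZeroMean f → f ≠ 0 →
      ∃ e₀ ν₀ : ℝ, 0 < e₀ ∧ 0 < ν₀ ∧ ∃ N₀ : ℕ, ∀ ν : ℝ, 0 < ν → ν ≤ ν₀ → ∀ N : ℕ, N₀ ≤ N →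
        ∀ μ : Measure (Torus.energySpace (Fin 3)), IsProbabilityMeasure μ →
          (∀ᵐ u ∂μ, IsLevel N u) →
          Integrable (fun u : Torus.energySpace (Fin 3) => ‖u‖ ^ 2) μ →
          IsPolyStationary ν f N 2 μ →
          e₀ ≤ Torus.ensembleEnergy μ) →
    (∃ f : UnitAddTorus (Fin 3) → EuclideanSpace ℝ (Fin 3),
      Torus.IsSmooth f ∧ Torus.IsDivFree f ∧ Torus.HasZeroMean f ∧ f ≠ 0 ∧
      ∃ (ν : ℕ → ℝ) (κ : ℝ), (∀ j, 0 < ν j) ∧ Tendsto ν atTop (𝓝 0) ∧ 0 < κ ∧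
        ∀ j : ℕ, ∃ R : ℝ, ∃ᶠ N in atTop, ∃ μ : Measure (Torus.energySpace (Fin 3)),
          IsProbabilityMeasure μ ∧ (∀ᵐ u ∂μ, IsLevel N u) ∧ (∀ᵐ u ∂μ, ‖u‖ ≤ R) ∧
          (∀ d : ℕ, IsPolyStationary (ν j) f N d μ) ∧
          κ * Torus.ensembleEnergy μ ≤ Torus.ensembleDissipation (ν j) μ) →
    ∃ f : UnitAddTorus (Fin 3) → EuclideanSpace ℝ (Fin 3),
      Torus.IsSmooth f ∧ Torus.IsDivFree f ∧ Torus.HasZeroMean f ∧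
      ∃ (ν : ℕ → ℝ) (E ε : ℝ), (∀ j, 0 < ν j) ∧ Tendsto ν atTop (𝓝 0) ∧ 0 < ε ∧
        ∀ j : ℕ, ∃ R : ℝ, ∃ᶠ N in atTop, ∃ μ : Measure (Torus.energySpace (Fin 3)),
          IsProbabilityMeasure μ ∧ (∀ᵐ u ∂μ, IsLevel N u) ∧ (∀ᵐ u ∂μ, ‖u‖ ≤ R) ∧
          (∀ (m : ℕ) (g : Fin m → UnitAddTorus (Fin 3) → EuclideanSpace ℝ (Fin 3))
              (P : MvPolynomial (Fin m) ℝ), (∀ i, IsBandTest N (g i)) →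
            Integrable (fun u => Torus.nsGeneratorPairing (ν j) f u (polyGrad g P u)) μ ∧
              ∫ u, Torus.nsGeneratorPairing (ν j) f u (polyGrad g P u) ∂μ = 0) ∧
          Torus.ensembleEnergy μ ≤ E ∧ ε ≤ Torus.ensembleDissipation (ν j) μ :=
  -- LANDED (wave 1, p88725): Theorems/MomentParityGalerkinInvariantLoudStubTaylorReduction.lean
  Summit.AnomalousDissipation.AnomalousDissipation.Theorems.GalerkinInvariantLoud.TaylorReduction.stub_taylorReduction

/-- **S3 — KRYLOV–BOGOLIUBOV AT LEVEL `N`, RATIO FORM (shared support lemma: also card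
`conley-continuation-loud-saddles`' `GalerkinKrylovBogoliubov` and card `rayleigh-floor-one-trajectory`'s
`ratioFloor_of_oneTrajectory` — triage: "file it ONCE").** Fix `ν > 0`, a smooth admissible `f`, a level `N`,
a real `κ` and a mean-zero Galerkin datum `a` of order `N` whose orbit `u(t) = galerkinFlow ν f N t a` has
cumulative Taylor ratio `liminf_T ν∫₀ᵀ‖∇u‖² / ∫₀ᵀ|u|² ≥ κ`. Then some Borel probability law on `H` is
level-`N` carried, carried by the ABSORBING BALL `‖u‖ ≤ ‖f‖₂/(4π²ν)`, all-order invariant for Galerkin NS at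
`(ν, f)`, and in the cone `κ·e(μ) ≤ D(μ)`.
Why true (L, provable now — standard, but the Galerkin K–B step is not yet in tree): the orbit is global,
stays a mean-zero Galerkin mode (`IsGalerkinMode.galerkinFlow_clauses`; the mean is conserved and `a`, `f` are
mean-zero) and is bounded (exact energy identity ⇒ `limsup|u(t)| ≤ ‖P_N f‖₂/(4π²ν)`), so the empirical laws
`μ_T = T⁻¹∫₀ᵀ δ_{u(t)}dt`, pushed to `H` (`smoothSolenoidal ⊆ energySpace`), live on a compact subset of the
finite-dimensional `P_N H`: a subsequence `T_n → ∞` converges weakly (or use a Banach limit as in the tree's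
`exists_timeAverageMeasure_holds` / `IsTimeAverageMeasure`). Level-`N` and the closed balls `‖u‖ ≤ ρ'`,
`ρ' > ‖f‖₂/(4π²ν)`, are closed sets of full `μ_{T_n}`-mass eventually ⇒ full `μ`-mass (Portmanteau), and
`⋂_{ρ'} = ` the absorbing ball (alternatively: cdisprove §3 `ae_norm_le_absorbing` re-derives the absorbing
radius from invariance alone). Invariance: for a polynomial cylindrical `Φ = P((u,g₁),…,(u,gₘ))` with band
tests `gᵢ` (Galerkin modes of order `N`), the tested Galerkin equations (clause 4 of `galerkinFlow_clauses`,
integrand `= nsGeneratorPairing ν f u gᵢ` since `inertialPairing(u,g) = ∫⟪u, convect u g⟫`) and the chain rule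
give `T⁻¹(Φ(u(T)) − Φ(u(0))) = ∫ LΦ dμ_T`, `LΦ(u) = nsGeneratorPairing ν f u (polyGrad g P u)` continuous on
`H` and bounded on the orbit closure ⇒ `∫ LΦ dμ = 0`. Ratio: test the CONTINUOUS bounded observables `|u|²∧C`
and `ν·eGradNormSq(fourierTruncate N u) ∧ C` (the truncated enstrophy is continuous on `L²` and equals
`‖∇u‖²` on level-`N` fields): `e(μ_{T_n}) → e(μ)`, `D(μ_{T_n}) → D(μ)`, and
`D(μ_T) ≥ (κ − δ)e(μ_T)` eventually in `T` for every `δ > 0` (`κ ≤ liminf`, ratio bounded below by `0`), so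
`D(μ) ≥ κe(μ)` (if `e(μ) = 0` the cone inequality is `0 ≤ D`, true). No positivity of `κ` is needed. -/
theorem stub_krylovBogoliubov :
    ∀ (ν : ℝ) (f : UnitAddTorus (Fin 3) → EuclideanSpace ℝ (Fin 3)) (N : ℕ) (κ : ℝ)
      (a : UnitAddTorus (Fin 3) → EuclideanSpace ℝ (Fin 3)),
      0 < ν → Torus.IsSmooth f → Torus.IsDivFree f → Torus.HasZeroMean f →
      IsGalerkinMode N a → Torus.HasZeroMean a →
      κ ≤ Filter.liminf (fun T : ℝ =>
          (ν * (∫⁻ t in Ioo 0 T, Torus.eGradNormSq (Torus.galerkinFlow ν f N t a)).toReal) /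
            (∫ t in (0 : ℝ)..T, ∫ x, ‖Torus.galerkinFlow ν f N t a x‖ ^ 2)) atTop →
      ∃ μ : Measure (Torus.energySpace (Fin 3)),
        IsProbabilityMeasure μ ∧ (∀ᵐ u ∂μ, IsLevel N u) ∧
        (∀ᵐ u ∂μ, ‖u‖ ≤ Real.sqrt (∫ x, ‖f x‖ ^ 2) / (4 * Real.pi ^ 2 * ν)) ∧
        (∀ d : ℕ, IsPolyStationary ν f N d μ) ∧
        κ * Torus.ensembleEnergy μ ≤ Torus.ensembleDissipation ν μ :=
  -- LANDED (wave 1, p90945 + helper A p88208): Theorems/MomentParityGalerkinInvariantLoudStubKrylovBogoliubov(A).lean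
  Summit.AnomalousDissipation.AnomalousDissipation.Theorems.GalerkinInvariantLoud.KrylovBogoliubov.stub_krylovBogoliubov

/-- **S4 — ONE TRAJECTORY AT THE TAYLOR SCALE (THE LOAD-BEARING OPEN STUB; the zeroth law in this line's
currency).** For SOME smooth divergence-free mean-zero force `f ≠ 0`, SOME positive viscosities `ν_j → 0` and
ONE `κ > 0`: for every `j`, for infinitely many Galerkin levels `N`, ONE mean-zero Galerkin datum `a` of order
`N` whose orbit under the level-`N` Galerkin semiflow at `(ν_j, f)` has cumulative dissipation-to-energy ratio
`liminf_{T→∞} ν_j∫₀ᵀ‖∇u‖²dt / ∫₀ᵀ‖u‖²_{L²}dt ≥ κ` — time-mean Taylor microscale `λ_T ≤ (ν_j/κ)^{1/2}`, i.e.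
spectral centroid at or above the Taylor wavenumber, UNIFORMLY in `j`. One datum, one number: no energy bound,
no support radius, no pointwise floor, no window, no running-average uniformity — energy and loudness are
recovered by S1/S2, the invariant law by S3. `f ≠ 0` is load-bearing (with `f = 0` the decaying shear
eigenmode `e_{k_j}`, `4π²|k_j|²ν_j ≥ κ`, has ratio `≡ 4π²|k_j|²ν_j`: TRIAGE-r1-2); with `f ≠ 0` transients wash
out because every invariant law of the forced truncation has `e ≥ e₀(f) > 0` (S1), so the liminf is a property
of the `ω`-limit dynamics, and a laminar `ω`-limit (ratio `νλ_f → 0`) fails it — the Disproof's "the laminar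
family never serves" in one line; its §4 efficient steady atoms are exactly the constant-orbit witnesses.
Why it might be TRUE: it is the converged-DNS zeroth law (Kaneda et al. 2003, doi:10.1063/1.1539855:
`ε = ν⟨‖∇u‖²⟩ → const`, `⟨|u|²⟩ = O(1)` along `ν → 0` at resolved `N ≍ k_η`), read on ONE long run per
`(ν, N)`; Disproof kit numbers (card j012263/j012367, Taylor–Green `N = 10`): `κ_KB = 0.65 → 0.46` as
`ν = 3·10⁻³ → 10⁻³` (short windows, evidence only). Why it might FAIL: exactly iff GIL fails — `ν`-uniform
sub-Taylor laminarisation of every level-`N` Galerkin attractor for every force (true in 2-D: Alexakis–Doering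
`κ_τ² ≲ ν^{-1/2}`, route support `PlanarCubicQuiet`); Cheskidov arXiv:2311.04182 Thm 1.3 keeps `∃ f`
load-bearing. Entrances (none is a proof): ergodic optimisation of the cone functional
`h_κ(μ) = D(μ) − κe(μ)` over invariant laws (maximiser ergodic WLOG; periodic maximisers would need a
Contreras-type theorem for this flow — TRIAGE: toothless today); route MirrorVariety's
`TaylorGreenLoudGalerkinStates` / `GalerkinSteadyZerothLaw` in ratio form (efficient steady states = constant
orbits); UPO searches maximising `ν⟨‖∇u‖²⟩/⟨|u|²⟩` (Kawahara–Kida, van Veen). Size XL. -/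
theorem stub_oneTrajectoryTaylor :
    ∃ f : UnitAddTorus (Fin 3) → EuclideanSpace ℝ (Fin 3),
      Torus.IsSmooth f ∧ Torus.IsDivFree f ∧ Torus.HasZeroMean f ∧ f ≠ 0 ∧
      ∃ (ν : ℕ → ℝ) (κ : ℝ), (∀ j, 0 < ν j) ∧ Tendsto ν atTop (𝓝 0) ∧ 0 < κ ∧
        ∀ j : ℕ, ∃ᶠ N in atTop, ∃ a : UnitAddTorus (Fin 3) → EuclideanSpace ℝ (Fin 3),
          IsGalerkinMode N a ∧ Torus.HasZeroMean a ∧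
          κ ≤ Filter.liminf (fun T : ℝ =>
            (ν j * (∫⁻ t in Ioo 0 T, Torus.eGradNormSq (Torus.galerkinFlow (ν j) f N t a)).toReal) /
              (∫ t in (0 : ℝ)..T, ∫ x, ‖Torus.galerkinFlow (ν j) f N t a x‖ ^ 2)) atTop := by
  sorry

/-! ## The composition (kernel-checked; no sorry of its own) -/

/-- **`GalerkinInvariantLoud` from the four stubs.** S4 gives `f ≠ 0`, `ν_j → 0`, `κ > 0` and, per `j`,
`N`-frequently one orbit with Taylor ratio `≥ κ`; S3 turns each into an invariant level-`N` law in the cone,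
carried by the absorbing ball of radius `R_j := ‖f‖₂/(4π²ν_j)` (uniform in `N`, as the crux's clause order
`∃ R ∃ᶠ N` demands) — this is TSE; S2 with the floor S1 converts the cone into the crux's window. -/
theorem GalerkinInvariantLoud_of : GalerkinInvariantLoud := by
  refine stub_taylorReduction stub_energyFloor ?_
  obtain ⟨f, hfs, hfd, hfz, hf0, ν, κ, hν, hν0, hκ, hj⟩ := stub_oneTrajectoryTaylor
  refine ⟨f, hfs, hfd, hfz, hf0, ν, κ, hν, hν0, hκ, fun j => ?_⟩
  refine ⟨Real.sqrt (∫ x, ‖f x‖ ^ 2) / (4 * Real.pi ^ 2 * ν j), (hj j).mono ?_⟩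
  rintro N ⟨a, ha, ha0, hlim⟩
  exact stub_krylovBogoliubov (ν j) f N κ a (hν j) hfs hfd hfz ha ha0 hlim

/-! ## Proved companions (not stubs) -/

/-- A law supported in a ball has moments of every order (copy of the landed
`GalerkinInvariantLoud.Negative.integrable_norm_pow_of_ae_le`, whose module is not yet built on the farm). -/
theorem integrable_norm_pow_of_ae_le' {μ : Measure (Torus.energySpace (Fin 3))} [IsFiniteMeasure μ] {R : ℝ}
    (hR : ∀ᵐ u ∂μ, ‖u‖ ≤ R) (p : ℕ) : Integrable (fun u : Torus.energySpace (Fin 3) => ‖u‖ ^ p) μ := by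
  refine Integrable.mono' (integrable_const (max R 0 ^ p)) (continuous_norm.pow p).aestronglyMeasurable ?_
  filter_upwards [hR] with u hu
  rw [Real.norm_of_nonneg (by positivity)]
  exact pow_le_pow_left₀ (norm_nonneg _) (hu.trans (le_max_left _ _)) p

/-- **TaylorConverse (PROVED): the transfer is lossless — GIL ⇒ TSE with `κ := ε/E`.** A witness at `j = 0`
gives `ε ≤ ‖f‖₂√E` (energy row + Cauchy–Schwarz: landed `ensembleDissipation_le_of_polyStationary`, i.e.
cdisprove `dissipation_eq`/`eps_le_force`), whence `E > 0` and `f ≠ 0`; then `(ε/E)·e ≤ (ε/E)·E = ε ≤ D` on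
every witness. With `stub_taylorReduction` this makes TSE EQUIVALENT to the crux: the cone is a
reparametrisation that lowers nothing by itself (TRIAGE, honest limits) — its value is the currency (one ratio)
that S3/S4 and the disprover's certificate target are paid in. -/
theorem taylorConverse (h : GalerkinInvariantLoud) :
    ∃ f : UnitAddTorus (Fin 3) → EuclideanSpace ℝ (Fin 3),
      Torus.IsSmooth f ∧ Torus.IsDivFree f ∧ Torus.HasZeroMean f ∧ f ≠ 0 ∧
      ∃ (ν : ℕ → ℝ) (κ : ℝ), (∀ j, 0 < ν j) ∧ Tendsto ν atTop (𝓝 0) ∧ 0 < κ ∧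
        ∀ j : ℕ, ∃ R : ℝ, ∃ᶠ N in atTop, ∃ μ : Measure (Torus.energySpace (Fin 3)),
          IsProbabilityMeasure μ ∧ (∀ᵐ u ∂μ, IsLevel N u) ∧ (∀ᵐ u ∂μ, ‖u‖ ≤ R) ∧
          (∀ d : ℕ, IsPolyStationary (ν j) f N d μ) ∧
          κ * Torus.ensembleEnergy μ ≤ Torus.ensembleDissipation (ν j) μ := by
  obtain ⟨f, hfs, hfd, hfz, ν, E, ε, hν, hν0, hε, hj⟩ := h
  -- one witness (at `j = 0`) gives the force floor `ε ≤ ‖f‖₂ √E`, whence `0 < E` and `f ≠ 0`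
  obtain ⟨R₀, hR₀⟩ := hj 0
  obtain ⟨N₀, μ₀, hp₀, hl₀, hRμ₀, hinv₀, hE₀, hε₀⟩ := hR₀.exists
  have hforce : ε ≤ Real.sqrt (∫ x, ‖f x‖ ^ 2) * Real.sqrt E := by
    haveI := hp₀
    have h2 : Integrable (fun u : Torus.energySpace (Fin 3) => ‖u‖ ^ 2) μ₀ :=
      integrable_norm_pow_of_ae_le' hRμ₀ 2
    have hst : IsPolyStationary (ν 0) f N₀ 3 μ₀ := fun m g P hg _ => hinv₀ m g P hg
    calc ε ≤ Torus.ensembleDissipation (ν 0) μ₀ := hε₀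
      _ ≤ Real.sqrt (∫ x, ‖f x‖ ^ 2) * Real.sqrt (Torus.ensembleEnergy μ₀) :=
          ensembleDissipation_le_of_polyStationary f (hfs.memLp 2) hl₀ h2 le_rfl hst
      _ ≤ Real.sqrt (∫ x, ‖f x‖ ^ 2) * Real.sqrt E := by gcongr
  have hE : 0 < E := by
    by_contra hE
    push Not at hE
    have h0 : Real.sqrt E = 0 := Real.sqrt_eq_zero'.mpr hE
    rw [h0, mul_zero] at hforce
    linarith
  have hf0 : f ≠ 0 := by
    rintro rfl
    have h0 : (∫ x : UnitAddTorus (Fin 3),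
        ‖(0 : UnitAddTorus (Fin 3) → EuclideanSpace ℝ (Fin 3)) x‖ ^ 2) = 0 := by
      simp
    rw [h0, Real.sqrt_zero, zero_mul] at hforce
    linarith
  refine ⟨f, hfs, hfd, hfz, hf0, ν, ε / E, hν, hν0, div_pos hε hE, fun j => ?_⟩
  obtain ⟨R, hR⟩ := hj j
  refine ⟨R, hR.mono ?_⟩
  rintro N ⟨μ, hp, hl, hRμ, hinv, hEμ, hεμ⟩
  refine ⟨μ, hp, hl, hRμ, fun d m g P hg _ => hinv m g P hg, ?_⟩
  calc ε / E * Torus.ensembleEnergy μ ≤ ε / E * E :=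
        mul_le_mul_of_nonneg_left hEμ (div_pos hε hE).le
    _ = ε := div_mul_cancel₀ ε hE.ne'
    _ ≤ Torus.ensembleDissipation (ν j) μ := hεμ

/-- **Taylor level (PROVED; honours `not_gilBoundedLevel` in cone form).** A cone witness with positive mean
energy lives at a level reaching the Taylor wavenumber: `κ ≤ 4π²N²ν`, i.e. `N ≥ (κ/ν)^{1/2}/(2π)` — so S4's
data must sit at `N ≳ ν_j^{-1/2}`, which is why it asks `∃ᶠ N` and never a bounded level. Bernstein via the
landed `IsQuarticWitness.eps_le` with `E := e(μ)`, `ε := κ·e(μ)`. -/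
theorem cone_level {f : UnitAddTorus (Fin 3) → EuclideanSpace ℝ (Fin 3)} {ν : ℝ} (hν : 0 ≤ ν) {N : ℕ}
    {R κ : ℝ} {μ : Measure (Torus.energySpace (Fin 3))} (hp : IsProbabilityMeasure μ)
    (hl : ∀ᵐ u ∂μ, IsLevel N u) (hR : ∀ᵐ u ∂μ, ‖u‖ ≤ R) (hinv : ∀ d : ℕ, IsPolyStationary ν f N d μ)
    (hcone : κ * Torus.ensembleEnergy μ ≤ Torus.ensembleDissipation ν μ)
    (he : 0 < Torus.ensembleEnergy μ) :
    κ ≤ 4 * Real.pi ^ 2 * (N : ℝ) ^ 2 * ν := by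
  have hW : IsQuarticWitness f ν N (Torus.ensembleEnergy μ) (κ * Torus.ensembleEnergy μ) μ :=
    ⟨hp, hl, integrable_norm_pow_of_ae_le' hR 4, hinv 4, le_rfl, hcone⟩
  exact le_of_mul_le_mul_right (hW.eps_le hν) he

/-! ## Disprover-facing half (PROVED): one-multiplier certificates exclude the cone -/

/-- The dissipation of a law carried by level-`N` fields is a Bochner integral: the spectral enstrophy is
lower semicontinuous on `H` (hence Borel) and finite on level-`N` fields (Bernstein), so
`ν·(∫⁻‖∇u‖²dμ).toReal = ν∫(‖∇u‖²).toReal dμ`. -/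
theorem ensembleDissipation_eq_integral_of_isLevel {ν : ℝ} {N : ℕ}
    {μ : Measure (Torus.energySpace (Fin 3))} (hl : ∀ᵐ u ∂μ, IsLevel N u) :
    Torus.ensembleDissipation ν μ =
      ν * ∫ u, (Torus.eGradNormSq (u.1 : UnitAddTorus (Fin 3) → EuclideanSpace ℝ (Fin 3))).toReal ∂μ := by
  have hm : AEMeasurable (fun u : Torus.energySpace (Fin 3) =>
      Torus.eGradNormSq (u.1 : UnitAddTorus (Fin 3) → EuclideanSpace ℝ (Fin 3))) μ :=
    (Torus.lowerSemicontinuous_eGradNormSq_coe (d := Fin 3)).measurable.aemeasurable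
  have hfin : ∀ᵐ u ∂μ,
      Torus.eGradNormSq (u.1 : UnitAddTorus (Fin 3) → EuclideanSpace ℝ (Fin 3)) < ⊤ :=
    hl.mono fun u hu => (eGradNormSq_le_of_level u.1 hu).trans_lt
      (ENNReal.mul_lt_top ENNReal.ofReal_lt_top (ENNReal.pow_lt_top enorm_lt_top))
  rw [integral_toReal hm hfin]
  rfl

/-- `(‖∇u‖²).toReal ≤ 4π²N²‖u‖²` on level-`N` fields (Bernstein, real form; cf. cdisprove
`toReal_eGradNormSq_le_of_isLevel`). -/
theorem toReal_eGradNormSq_le_of_isLevel' {N : ℕ} {u : Torus.energySpace (Fin 3)} (hu : IsLevel N u) :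
    (Torus.eGradNormSq (u.1 : UnitAddTorus (Fin 3) → EuclideanSpace ℝ (Fin 3))).toReal ≤
      4 * Real.pi ^ 2 * (N : ℝ) ^ 2 * ‖u‖ ^ 2 := by
  have h := eGradNormSq_le_of_level u.1 hu
  have hfin : ENNReal.ofReal (4 * Real.pi ^ 2 * (N : ℝ) ^ 2) * ‖u.1‖ₑ ^ 2 ≠ ⊤ :=
    ENNReal.mul_ne_top ENNReal.ofReal_ne_top (ENNReal.pow_ne_top enorm_ne_top)
  have h2 := ENNReal.toReal_mono hfin h
  rw [ENNReal.toReal_mul, ENNReal.toReal_ofReal (by positivity), ← ofReal_norm,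
    ← ENNReal.ofReal_pow (norm_nonneg _), ENNReal.toReal_ofReal (by positivity)] at h2
  simpa using h2

/-- **One-multiplier certificates exclude the cone (PROVED; the disprover's target in closed form).**
At fixed `(ν, N)` let `V = P((u,g₁),…,(u,gₘ))` be a polynomial cylindrical observable (any test fields) whose
generator row obeys the Tobasco–Goluskin–Doering inequality
`LV(u) + δ ≤ κ|u|² − ν‖∇u‖²` on the level-`N` fields of the ball `‖u‖ ≤ ρ`
(`LV(u) = nsGeneratorPairing ν f u (∇V(u))`). Then every level-`N` probability law supported in that ball
whose `V`-row vanishes (in particular every all-order invariant law, when the `gᵢ` are band tests) satisfies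
`D(μ) + δ ≤ κ·e(μ)` — it is NOT in the cone `κe ≤ D` once `δ > 0`. So `¬TSE` at `(ν_j, N)` with the
absorbing radius `ρ = ‖f‖₂/(4π²ν_j)` follows from ONE such certificate per large `N`; by the card's Barrier
notes its polynomial instances of `ν`-bounded degree degenerate (top-degree part forced into `ℝ[E, H]`), which
is the shape of the difficulty on the negative side. Proof: integrate the inequality against `μ`. -/
theorem certificate_excludes_cone {f : UnitAddTorus (Fin 3) → EuclideanSpace ℝ (Fin 3)} {ν κ δ ρ : ℝ}
    {N m : ℕ} (g : Fin m → UnitAddTorus (Fin 3) → EuclideanSpace ℝ (Fin 3)) (P : MvPolynomial (Fin m) ℝ)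
    (hcert : ∀ u : Torus.energySpace (Fin 3), IsLevel N u → ‖u‖ ≤ ρ →
      Torus.nsGeneratorPairing ν f u (polyGrad g P u) + δ ≤
        κ * ‖u‖ ^ 2 - ν * (Torus.eGradNormSq (u.1 : UnitAddTorus (Fin 3) → EuclideanSpace ℝ (Fin 3))).toReal)
    {μ : Measure (Torus.energySpace (Fin 3))} [IsProbabilityMeasure μ]
    (hl : ∀ᵐ u ∂μ, IsLevel N u) (hR : ∀ᵐ u ∂μ, ‖u‖ ≤ ρ)
    (hrow : Integrable (fun u => Torus.nsGeneratorPairing ν f u (polyGrad g P u)) μ ∧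
      ∫ u, Torus.nsGeneratorPairing ν f u (polyGrad g P u) ∂μ = 0) :
    Torus.ensembleDissipation ν μ + δ ≤ κ * Torus.ensembleEnergy μ := by
  have h2 : Integrable (fun u : Torus.energySpace (Fin 3) => ‖u‖ ^ 2) μ := integrable_norm_pow_of_ae_le' hR 2
  have hGm : AEStronglyMeasurable (fun u : Torus.energySpace (Fin 3) =>
      (Torus.eGradNormSq (u.1 : UnitAddTorus (Fin 3) → EuclideanSpace ℝ (Fin 3))).toReal) μ :=
    (Torus.lowerSemicontinuous_eGradNormSq_coe (d := Fin 3)).measurable.ennreal_toReal.aestronglyMeasurable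
  have hGint : Integrable (fun u : Torus.energySpace (Fin 3) =>
      (Torus.eGradNormSq (u.1 : UnitAddTorus (Fin 3) → EuclideanSpace ℝ (Fin 3))).toReal) μ := by
    refine Integrable.mono' (h2.const_mul (4 * Real.pi ^ 2 * (N : ℝ) ^ 2)) hGm ?_
    filter_upwards [hl] with u hu
    rw [Real.norm_of_nonneg ENNReal.toReal_nonneg]
    exact toReal_eGradNormSq_le_of_isLevel' hu
  have hI1 : Integrable (fun u : Torus.energySpace (Fin 3) =>
      Torus.nsGeneratorPairing ν f u (polyGrad g P u) + δ) μ := hrow.1.add (integrable_const δ)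
  have hI2 : Integrable (fun u : Torus.energySpace (Fin 3) => κ * ‖u‖ ^ 2 -
      ν * (Torus.eGradNormSq (u.1 : UnitAddTorus (Fin 3) → EuclideanSpace ℝ (Fin 3))).toReal) μ :=
    (h2.const_mul κ).sub (hGint.const_mul ν)
  have hineq : ∀ᵐ u ∂μ, Torus.nsGeneratorPairing ν f u (polyGrad g P u) + δ ≤ κ * ‖u‖ ^ 2 -
      ν * (Torus.eGradNormSq (u.1 : UnitAddTorus (Fin 3) → EuclideanSpace ℝ (Fin 3))).toReal := by
    filter_upwards [hl, hR] with u hu hur using hcert u hu hur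
  have hint := integral_mono_ae hI1 hI2 hineq
  have hA : ∫ u, Torus.nsGeneratorPairing ν f u (polyGrad g P u) + δ ∂μ = δ := by
    rw [integral_add hrow.1 (integrable_const δ), hrow.2, integral_const, smul_eq_mul, probReal_univ]
    ring
  have hB : ∫ u, κ * ‖u‖ ^ 2 -
      ν * (Torus.eGradNormSq (u.1 : UnitAddTorus (Fin 3) → EuclideanSpace ℝ (Fin 3))).toReal ∂μ =
      κ * Torus.ensembleEnergy μ - Torus.ensembleDissipation ν μ := by
    rw [integral_sub (h2.const_mul κ) (hGint.const_mul ν), integral_const_mul, integral_const_mul,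
      ensembleDissipation_eq_integral_of_isLevel hl]
    rfl
  rw [hA, hB] at hint
  linarith

end

end Summit.AnomalousDissipation.AnomalousDissipation.Cruxes.GalerkinInvariantLoud.TaylorConeHomogenisation
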